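import Mathlib
import HarnessLib
import Summits.Ventures.LatticeQCDFlow.Exactness.JitteredHMC
import Summits.Ventures.LatticeQCDFlow.Exactness.SUNWilsonForceLaw

/-!
# The engine's `SU(N)` leapfrog HMC with `tau_jitter`: exact for EVERY jitter law; uniformly ergodic whenever an atom of the jitter law is a short trajectory

HONEST FRAMING: exact (Metropolis-corrected) sampling algorithms for lattice gauge theory;
figures of merit are autocorrelation/cost numbers at stated couplings and volumes; no
continuum-physics claim.

Venture `LatticeQCDFlow` (cell pub-lqcd), topic `Exactness`, FANOUT row 9 (eng-latcore, the engine's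
`latflow.core.hmc.HMC(f, β, 'leapfrog').trajectory(rng, τ, nstep, tau_jitter = j)` on `SU(N)`: the
trajectory length is `τ_u = τ(1 + j(2u − 1))` with `u ∼ U(0,1)` drawn before and independently of the
field, the step is `ε_u = τ_u/nstep`, the half kicks are `−(ε_u/2)·F(U)` with the engine's force
`F(U) = (β/2N)·TA(U_e R_e(U))`).  NEW WORK of the cell over the tree (`JitteredHMC.lean`: `jitterHMC`,
`jitterHMC_exact`, `jitterHMC_apply`, `jitterHMC_uniformlyErgodic_of_atom`; `SUNMultiStepLeapfrogHMC.lean`: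
`sunLeapfrogProposalN`, `sunLeapfrogHMCN`, `…_invariant`; `SUNMultiStepLeapfrogHMCErgodic.lean`:
`sunLeapfrogHMCN_nHit_minorised`; `SUNMultiStepLeapfrogHMCEngine.lean`: the engine's coordinates / kinetic
term, `trajLength_threshold_arith`; `SUNForceRegularity.lean`; `SUNWilsonForceLaw.lean`: the engine's force
law, `wilson_sunWilsonForceHMCN_uniformlyErgodic`; `SUNLeapfrogHMCWilson.lean`); nothing is cited as a
fact; no number is claimed.  Printed counterparts, NAMED ONLY: Duane–Kennedy–Pendleton–Roweth 1987,
Mackenzie 1989.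

* §1 (any coordinates `ι : E → 𝔰𝔲(n)`, any additive Haar `μ`, any kinetic term `T`, any action `S`, a
  COUNTABLE label set — every floating-point jitter law is one) **`sunJitterHMCN`** — the engine's leapfrog
  HMC update with the step `ε_l`, the step number `N_l` and the increment `g_l` chosen by a label `l ∼ η`
  drawn with the momentum (the engine jitters `τ` at fixed `nstep`; Mackenzie 1989 jitters the step number);
  `sunJitterHMCN_apply` — it IS `Σ_l η{l} · K_l` (the mixture of the fixed-step kernels `sunLeapfrogHMCN`);
  **`sunJitterHMCN_invariant`** / `_invariant_gibbs` — EXACT for EVERY probability law `η`, every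
  `ε : labels → ℝ`, `N : labels → ℕ`, every measurable increments, every measurable `S`
  (`jitterHMC_exact`: it is HMC with the enlarged momentum `(p, l)`).
* §2 (the engine's coordinates `sunCoordι N`, kinetic term `sunKinetic N`, Gaussian refresh)
  `engine_sunLeapfrogHMCN_nHit_minorised` / **`engine_sunLeapfrogHMCN_nHit_minorised_of_trajLength`** — the
  Doeblin POWER behind the tree's short-trajectory convergence theorems, stated: for a measurable force
  field bounded per link and Lipschitz there is `τ₀ > 0` such that for every `n ≥ 1`, `ε > 0` with
  `nε ≤ τ₀` some power `K^{k+1}` of the fixed-step kernel dominates `δ · Haar^{⊗links}`, `δ > 0`, from EVERY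
  configuration.
* §3 (torus `(ℤ/L)^d`, `G = SU(N)`, the engine's Wilson force law and action `(β/N)·S_W`)
  **`wilson_sunWilsonForceJitterHMC_invariant`** — THE ENGINE'S JITTERED HMC AS RUN LEAVES THE WILSON MEASURE
  INVARIANT, for EVERY step-number assignment `nstep : labels → ℕ`, EVERY trajectory-length assignment
  `τ : labels → ℝ` and EVERY jitter law `η`;
  **`wilson_sunWilsonForceJitterHMC_uniformlyErgodic`** — there is `τ₀ > 0` (on `N, d, L, β` only; not
  computed) such that for every `nstep`, every `τ`, every jitter law `η` with an ATOM `l₀` (`η{l₀} ≠ 0`,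
  `nstep l₀ ≥ 1`) whose trajectory length satisfies `0 < τ l₀ ≤ τ₀`: the jittered chain converges to
  `wilsonMeasure (β/N)` geometrically in total variation from EVERY initial law at every time, and the
  Wilson measure is its unique invariant probability law.

Reading for the engine (value-free): `tau_jitter` never costs exactness, whatever the law of `u`; and with
the code's 53-bit uniform `u` (a law with atoms) the jittered `SU(N)` HMC converges from every start as
soon as the shortest reachable trajectory `τ(1 − j)` (indeed any atom) is below the short-trajectory
threshold — in particular a jitter that reaches short trajectories makes a long-`τ` run provably ergodic,
which the fixed-length theorems do not give.  NOT CLAIMED: any value of `τ₀`, `k`, `δ`; ergodicity for an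
atomless (idealised continuous) jitter law; anything about long trajectories WITHOUT a short atom; OMF
words; floating point (`expm_taylor`).
-/

noncomputable section

namespace Summit.Ventures.LatticeQCDFlow.Exactness

open MeasureTheory ProbabilityTheory ProbabilityTheory.Kernel Set Metric Function
open Literature.MathematicalPhysics.QuantumFieldTheory
open Literature.MathematicalPhysics.QuantumLattice (fundamentalRep continuous_fundamentalRep)
open scoped ENNReal Matrix Matrix.Norms.Operator NNReal

set_option backward.isDefEq.respectTransparency false

/-! ## §1 The jittered `n`-step kernel: a countable mixture of fixed-step kernels, exact for every law -/

section General

variable {n : Type*} [Fintype n] [DecidableEq n]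
variable {E : Type*} [NormedAddCommGroup E] [NormedSpace ℝ E] [MeasurableSpace E] [BorelSpace E]
  [FiniteDimensional ℝ E]
variable (ι : E →ₗ[ℝ] Matrix n n ℂ) (hι : ∀ a, (ι a)ᴴ = -ι a ∧ (ι a).trace = 0)
variable {L : Type*} [Fintype L] (μ : Measure E) (T : (L → E) → ℝ)
variable {Lab : Type*} [Countable Lab] [MeasurableSpace Lab] [MeasurableSingletonClass Lab]
variable (ε : Lab → ℝ) {g : Lab → (L → Matrix.specialUnitaryGroup n ℂ) → L → E}
  (hg : ∀ l, Measurable (g l)) (S : (L → Matrix.specialUnitaryGroup n ℂ) → ℝ) (N : Lab → ℕ) (η : Measure Lab)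

/-- **THE JITTERED LEAPFROG HMC KERNEL ON `SU(N)^links`** (`trajectory(τ, nstep, tau_jitter)`; also
Mackenzie's randomised step NUMBER): refresh the momentum `p ∼ Z_T⁻¹e^{−T}·μ^{⊗links}` and an independent
label `l ∼ η`, run `N_l` P-first leapfrog steps of size `ε_l` with increment `g_l`, flip, Metropolis test on
`S + T`, forget `(p, l)`. -/
def sunJitterHMCN : Kernel (L → Matrix.specialUnitaryGroup n ℂ) (L → Matrix.specialUnitaryGroup n ℂ) :=
  jitterHMC (fun l => ⇑(sunLeapfrogProposalN ι hι (ε l) (g l) (N l)))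
    (measurable_jitterMap_of_countable fun l => measurable_sunLeapfrogProposalN ι hι (ε l) (N l) (hg l))
    S T η (sunMomentumLaw μ T)

variable {ε S N η T}

/-- **IT IS THE `η`-MIXTURE OF THE FIXED-STEP KERNELS**: `K_jit(U, A) = Σ_l K_{ε_l}(U, A) · η{l}` with
`K_l = sunLeapfrogHMCN ι hι ε_l μ T (g_l) S N_l`. -/
theorem sunJitterHMCN_apply [SFinite η] (hT : Measurable T) (hS : Measurable S)
    (U : L → Matrix.specialUnitaryGroup n ℂ) {A : Set (L → Matrix.specialUnitaryGroup n ℂ)} (hA : MeasurableSet A) :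
    sunJitterHMCN ι hι μ T ε hg S N η U A = ∑' l, sunLeapfrogHMCN ι hι (ε l) μ T (hg l) S (N l) U A * η {l} := by
  haveI : SFinite (sunMomentumLaw (L := L) μ T) := by unfold sunMomentumLaw sunMomentumWeight; infer_instance
  rw [sunJitterHMCN, jitterHMC_apply _ _ η _ hS hT U hA, lintegral_countable']
  rfl

/-- **EXACT FOR EVERY JITTER LAW** (every assignment of steps `ε_l` and step numbers `N_l`): the jittered kernel leaves `e^{−S}·Haar^{⊗links}`
invariant — every probability law `η` on the labels, every step assignment `ε`, every measurable increments
`g_l`, every measurable `S`, every measurable `T` with `Z_T < ∞`. -/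
theorem sunJitterHMCN_invariant [μ.IsAddHaarMeasure] [IsProbabilityMeasure η] (hT : Measurable T)
    (hZ : sunMomentumWeight (L := L) μ T univ ≠ ⊤) (hS : Measurable S) :
    Invariant (sunJitterHMCN ι hι μ T ε hg S N η)
      ((Measure.pi fun _ : L => haarProbability (Matrix.specialUnitaryGroup n ℂ)).withDensity
        fun u => ENNReal.ofReal (Real.exp (-S u))) :=
  jitterHMC_exact (vol := Measure.pi fun _ : L => haarProbability (Matrix.specialUnitaryGroup n ℂ))
    (volP := Measure.pi fun _ : L => μ) η hS hT (fun l => involutive_sunLeapfrogProposalN ι hι (ε l) (g l) (N l))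
    (fun l => measurePreserving_sunLeapfrogProposalN ι hι (ε l) (N l) μ (hg l))
    (sunMomentumWeight_univ_ne_zero μ T hT) hZ

/-- **… hence the Gibbs law `gibbsProbability Haar^{⊗links} e^{−S}` is invariant**, for every jitter law. -/
theorem sunJitterHMCN_invariant_gibbs [μ.IsAddHaarMeasure] [IsProbabilityMeasure η] (hT : Measurable T)
    (hZ : sunMomentumWeight (L := L) μ T univ ≠ ⊤) (hS : Measurable S) :
    Invariant (sunJitterHMCN ι hι μ T ε hg S N η)
      (gibbsProbability (Measure.pi fun _ : L => haarProbability (Matrix.specialUnitaryGroup n ℂ))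
        fun u => Real.exp (-S u)) :=
  invariant_gibbsProbability (sunJitterHMCN_invariant ι hι μ hg hT hZ hS)

end General

/-! ## §2 The Doeblin power of the engine's fixed-step kernel, stated -/

section Engine

variable (N : ℕ) [NeZero N] {L : Type*} [Fintype L] {ε : ℝ} {nstep : ℕ}
  {g : (L → Matrix.specialUnitaryGroup (Fin N) ℂ) → L → SUNCoords N}
  {S : (L → Matrix.specialUnitaryGroup (Fin N) ℂ) → ℝ} {b Kg s : ℝ}

/-- **A POWER OF THE ENGINE'S FIXED-STEP KERNEL IS DOEBLIN** (the engine's coordinates, kinetic term and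
Gaussian refresh; hypotheses of `engine_sunLeapfrogHMCN_uniformlyErgodic`): there are `k` and `δ > 0` with
`δ · Haar^{⊗links} ≤ K^{k+1}(U, ·)` for EVERY `U`. -/
theorem engine_sunLeapfrogHMCN_nHit_minorised (hε : 0 < ε) (hn : 1 ≤ nstep) (hg : Measurable g)
    (hb0 : 0 ≤ b) (hb : ∀ u l, ‖g u l‖ ≤ b) (hK0 : 0 ≤ Kg)
    (hK : ∀ U U', ‖g U - g U'‖ ≤ Kg * ‖coeConfig U - coeConfig U'‖) (hS : Measurable S) (hs : ∀ u, |S u| ≤ s)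
    (h1 : nstep * ε ≤ sunShortTrajThreshold (sunCoordι N) (sunCoordι_injective N))
    (h2 : (2 * nstep + 1) * b ≤ sunShortTrajThreshold (sunCoordι N) (sunCoordι_injective N))
    (h3 : Kg * ε * (nstep : ℝ) ^ 2 ≤ sunShortTrajThreshold (sunCoordι N) (sunCoordι_injective N)) :
    ∃ k : ℕ, ∃ δ : ℝ≥0∞, 0 < δ ∧ ∀ u,
      δ • Measure.pi (fun _ : L => haarProbability (Matrix.specialUnitaryGroup (Fin N) ℂ)) ≤
        nHit (sunLeapfrogHMCN (sunCoordι N) (sunCoordι_skew N) ε (Measure.addHaar : Measure (SUNCoords N))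
          (sunKinetic N) hg S nstep) (k + 1) u :=
  sunLeapfrogHMCN_nHit_minorised (sunCoordι N) (sunCoordι_skew N) (sunCoordι_injective N) Measure.addHaar
    (τ := fun R => Fintype.card L * ((N + 4 * Fintype.card (UpperPair N)) * R ^ 2))
    (sunCoordι_range N) hε hn (measurable_sunKinetic N) (sunKinetic_nonneg N)
    (sunKinetic_le_of_norm_le N) (sunMomentumWeight_sunKinetic_ne_top N Measure.addHaar) hg hb0 hb hK0 hK hS hs h1 h2 h3

variable {F : (L → Matrix.specialUnitaryGroup (Fin N) ℂ) → L → SUNCoords N} {Fmax KF : ℝ}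

/-- **THE SAME IN TRAJECTORY-LENGTH FORM**: for a measurable force field bounded by `F_max` per link and
`K_F`-Lipschitz and a measurable action bounded by `s` there is `τ₀ > 0` (coordinates, `F_max`, `K_F`
only) such that for EVERY `n ≥ 1`, `ε > 0` with `nε ≤ τ₀` some power of the engine's `n`-step kernel with
half kick `−(ε/2)·F` dominates `δ · Haar^{⊗links}`, `δ > 0`, from every configuration. -/
theorem engine_sunLeapfrogHMCN_nHit_minorised_of_trajLength (hF : Measurable F) (hF0 : 0 ≤ Fmax)
    (hFb : ∀ U l, ‖F U l‖ ≤ Fmax) (hKF0 : 0 ≤ KF) (hFK : ∀ U U', ‖F U - F U'‖ ≤ KF * ‖coeConfig U - coeConfig U'‖)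
    (hS : Measurable S) (hs : ∀ u, |S u| ≤ s) :
    ∃ τ₀ : ℝ, 0 < τ₀ ∧ ∀ (nstep : ℕ) (ε : ℝ), 1 ≤ nstep → 0 < ε → nstep * ε ≤ τ₀ →
      ∃ k : ℕ, ∃ δ : ℝ≥0∞, 0 < δ ∧ ∀ u,
        δ • Measure.pi (fun _ : L => haarProbability (Matrix.specialUnitaryGroup (Fin N) ℂ)) ≤
          nHit (sunLeapfrogHMCN (sunCoordι N) (sunCoordι_skew N) ε (Measure.addHaar : Measure (SUNCoords N))
            (sunKinetic N) (measurable_halfKick_sun N hF ε) S nstep) (k + 1) u := by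
  set s₀ := sunShortTrajThreshold (sunCoordι N) (sunCoordι_injective N) with hs₀
  have hs₀0 : 0 < s₀ := sunShortTrajThreshold_pos _ _
  refine ⟨min s₀ (min (s₀ / (3 * Fmax + 1)) (Real.sqrt (s₀ / (KF + 1)))),
    lt_min hs₀0 (lt_min (by positivity) (Real.sqrt_pos.2 (by positivity))), fun nstep ε hn hε hτ => ?_⟩
  obtain ⟨h1, h2, h3⟩ := trajLength_threshold_arith hs₀0 hF0 hKF0 hn hε rfl hτ
  refine engine_sunLeapfrogHMCN_nHit_minorised N hε hn (measurable_halfKick_sun N hF ε) (b := ε / 2 * Fmax)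
    (Kg := ε / 2 * KF) (by positivity) (fun U l => ?_) (by positivity) (fun U U' => ?_) hS hs h1 h2 h3
  · rw [Pi.smul_apply, norm_smul, Real.norm_eq_abs, abs_neg, abs_of_pos (by positivity)]
    exact mul_le_mul_of_nonneg_left (hFb U l) (by positivity)
  · have hsub : (-(ε / 2)) • F U - (-(ε / 2)) • F U' = (-(ε / 2)) • (F U - F U') := by
      funext l; simp only [Pi.sub_apply, Pi.smul_apply, smul_sub]
    rw [hsub, norm_smul, Real.norm_eq_abs, abs_neg, abs_of_pos (by positivity), mul_assoc]
    exact mul_le_mul_of_nonneg_left (hFK U U') (by positivity)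

end Engine

/-! ## §3 The engine's jittered `SU(N)` HMC as run: the Wilson action -/

section Wilson

variable (N : ℕ) [NeZero N] {d L : ℕ} [NeZero L]
variable {Lab : Type*} [Countable Lab] [MeasurableSpace Lab] [MeasurableSingletonClass Lab]

omit [NeZero N] in
/-- **THE ENGINE'S JITTERED `SU(N)` HMC AS RUN LEAVES THE WILSON MEASURE INVARIANT — FOR EVERY JITTER LAW.**
Torus `(ℤ/L)^d`, `G = SU(N)` (`N, L ≥ 1`), any real `β`, action `(β/N)·S_W`, the engine's momenta and
kinetic term; labels `l ∼ η` (ANY probability law on ANY countable label set — the code's `u` is a 53-bit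
uniform), trajectory length `τ_l` (ANY assignment), step numbers `nstep_l` (ANY assignment; the
engine fixes `nstep`), steps `τ_l/nstep_l` with THE ENGINE'S half kick `−(τ_l/2nstep_l)·F(U)`,
`F(U) = sunWilsonForceLaw N β (coeConfig U)`, Metropolis test.  Then `wilsonMeasure (β/N)` is invariant. -/
theorem wilson_sunWilsonForceJitterHMC_invariant (β : ℝ) (nstep : Lab → ℕ) (τ : Lab → ℝ) (η : Measure Lab)
    [IsProbabilityMeasure η] :
    Invariant
      (sunJitterHMCN (sunCoordι N) (sunCoordι_skew N) (Measure.addHaar : Measure (SUNCoords N)) (sunKinetic N)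
        (fun l => τ l / nstep l)
        (fun l => measurable_halfKick_sun N (measurable_sunWilsonForceLaw_coeConfig N (d := d) (L := L) β) (τ l / nstep l))
        (fun U => β / N * wilsonAction (fundamentalRep (Fin N)) U) nstep η)
      (wilsonMeasure (d := d) (L := L) (fundamentalRep (Fin N)) (β / N)) := by
  rw [← gibbsProbability_smul_wilsonAction_eq N (d := d) (L := L) (fundamentalRep (Fin N)) (β / N)]
  exact sunJitterHMCN_invariant_gibbs (sunCoordι N) (sunCoordι_skew N) Measure.addHaar _
    (measurable_sunKinetic N) (sunMomentumWeight_sunKinetic_ne_top N Measure.addHaar) (measurable_engineWilsonAction N β)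

/-- **THE ENGINE'S JITTERED `SU(N)` HMC AS RUN CONVERGES TO THE WILSON MEASURE FROM EVERY START WHENEVER AN
ATOM OF THE JITTER LAW IS A SHORT TRAJECTORY.**  Same setting.  There is `τ₀ > 0` (depending on `N, d, L, β`
only; not computed) such that for EVERY step-number assignment `nstep`, EVERY trajectory-length assignment `τ`,
EVERY jitter law `η` and EVERY label `l₀` with `η{l₀} ≠ 0`, `nstep l₀ ≥ 1` and `0 < τ l₀ ≤ τ₀` there are `k` and `δ ∈ (0, 1]` with
`|μ₀ K_jitᵗ(A) − wilsonMeasure (β/N) (A)| ≤ (1 − δ)^{⌊t/(k+1)⌋}` for EVERY initial law `μ₀`, every `t`,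
every `A`, and the Wilson measure is the unique invariant probability law of the jittered kernel. -/
theorem wilson_sunWilsonForceJitterHMC_uniformlyErgodic (β : ℝ) :
    ∃ τ₀ : ℝ, 0 < τ₀ ∧ ∀ (nstep : Lab → ℕ) (τ : Lab → ℝ) (η : Measure Lab) [IsProbabilityMeasure η] (l₀ : Lab),
      1 ≤ nstep l₀ → η {l₀} ≠ 0 → 0 < τ l₀ → τ l₀ ≤ τ₀ →
      ∃ k : ℕ, ∃ δ : ℝ, 0 < δ ∧ δ ≤ 1 ∧
        (∀ (μ₀ : Measure (GaugeConfig d L (Matrix.specialUnitaryGroup (Fin N) ℂ))) [IsProbabilityMeasure μ₀]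
          (t : ℕ) (A : Set (GaugeConfig d L (Matrix.specialUnitaryGroup (Fin N) ℂ))),
          |((fun m : Measure (GaugeConfig d L (Matrix.specialUnitaryGroup (Fin N) ℂ)) =>
                m.bind (sunJitterHMCN (sunCoordι N) (sunCoordι_skew N) (Measure.addHaar : Measure (SUNCoords N))
                  (sunKinetic N) (fun l => τ l / nstep l)
                  (fun l => measurable_halfKick_sun N (measurable_sunWilsonForceLaw_coeConfig N (d := d) (L := L) β)
                    (τ l / nstep l))
                  (fun U => β / N * wilsonAction (fundamentalRep (Fin N)) U) nstep η))^[t] μ₀).real A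
              - (wilsonMeasure (d := d) (L := L) (fundamentalRep (Fin N)) (β / N)).real A| ≤ (1 - δ) ^ (t / (k + 1))) ∧
        ∀ (π' : Measure (GaugeConfig d L (Matrix.specialUnitaryGroup (Fin N) ℂ))), IsProbabilityMeasure π' →
          Invariant (sunJitterHMCN (sunCoordι N) (sunCoordι_skew N) (Measure.addHaar : Measure (SUNCoords N))
            (sunKinetic N) (fun l => τ l / nstep l)
            (fun l => measurable_halfKick_sun N (measurable_sunWilsonForceLaw_coeConfig N (d := d) (L := L) β)
              (τ l / nstep l))
            (fun U => β / N * wilsonAction (fundamentalRep (Fin N)) U) nstep η) π' →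
          π' = wilsonMeasure (d := d) (L := L) (fundamentalRep (Fin N)) (β / N) := by
  obtain ⟨s, hs⟩ := exists_bound_smul_wilsonAction_sun N (d := d) (L := L) (fundamentalRep (Fin N))
    (continuous_fundamentalRep (Fin N)) (β / N)
  obtain ⟨Fmax, KF, hF0, hKF0, hFb, hFK⟩ := sunWilsonForceLaw_bounds N (d := d) (L := L) β
  obtain ⟨τ₀, hτ₀, hmin⟩ := engine_sunLeapfrogHMCN_nHit_minorised_of_trajLength N
    (measurable_sunWilsonForceLaw_coeConfig N (d := d) (L := L) β) hF0 hFb hKF0 hFK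
    (measurable_engineWilsonAction N β) hs
  refine ⟨τ₀, hτ₀, fun nstep τ η _ l₀ hn hl₀ hτl hτl₀ => ?_⟩
  haveI := isProbabilityMeasure_wilsonMeasure (d := d) (L := L) (fundamentalRep (Fin N))
    (continuous_fundamentalRep (Fin N)) (β / N)
  have hn0 : (0 : ℝ) < nstep l₀ := by exact_mod_cast hn
  have hε : 0 < τ l₀ / nstep l₀ := div_pos hτl hn0
  have hnε : (nstep l₀ : ℝ) * (τ l₀ / nstep l₀) ≤ τ₀ := by rwa [mul_div_cancel₀ _ hn0.ne']
  obtain ⟨k, δ, hδ, hpow⟩ := hmin (nstep l₀) (τ l₀ / nstep l₀) hn hε hnε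
  haveI := isProbabilityMeasure_sunMomentumLaw (L := Edge d L) (Measure.addHaar : Measure (SUNCoords N))
    (sunKinetic N) (measurable_sunKinetic N) (sunMomentumWeight_sunKinetic_ne_top N Measure.addHaar)
  have hinv := wilson_sunWilsonForceJitterHMC_invariant N (d := d) (L := L) β nstep τ η
  obtain ⟨δ', hδ'0, hδ'1, hconv, huniq⟩ := jitterHMC_uniformlyErgodic_of_atom (η := η)
    (μP := sunMomentumLaw (Measure.addHaar : Measure (SUNCoords N)) (sunKinetic N))
    (measurable_engineWilsonAction N β) (measurable_sunKinetic N) hinv hl₀ hδ.ne' (k := k)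
    (fun u => by simpa only [sunLeapfrogHMCN] using hpow u)
  exact ⟨k, δ', hδ'0, hδ'1, fun μ₀ _ t A => hconv μ₀ t A, fun π' hπ' hinv' => huniq π' hinv'⟩

end Wilson

end Summit.Ventures.LatticeQCDFlow.Exactness
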